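import Summits.ResolutionOfSingularities.ResolutionOfSingularities.Theorems.RadicialJungCleanModelsDimTwoStepOverField
import Summits.ResolutionOfSingularities.ResolutionOfSingularities.Theorems.RadicialJungCleanModelsDimTwoFFinite
import HarnessLib

/-!
# Loosely clean principalization at closed points, dimension 2, over an ARBITRARY field —
# conditionally on Giraud's theorem over the field (PROGRAMME-clean-dim2 / T2 glue B9)

Route `ResolutionOfSingularities/RadicialJung`, crux item `CleanModels`
(stmt-ResolutionOfSingularities-15917), line `via-clean-models` of crux `DescentPerfectToAll`
(stmt-0549), PROGRAMME-clean-dim2 (W8.1), T2 architecture brick B9. OURS; nothing here is a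
statement of Hironaka's manuscript.

This is the `section Main` of `RadicialJungCleanModelsDimTwoFFinite.lean` (line `Sketch` rev 10,
lead c2) with the `F`-finiteness hypothesis removed and Giraud's theorem taken in the OURS form
over the field `k` (`Giraud24OverField` of the T2 architecture, expanded as `hG`: integral regular
surfaces locally of finite type over `k`, normal form at CLOSED points): the induction over a finite
affine cover (`exists_model_over_list_overField`, step `exists_step_overField`) and the conclusion
`principalizationDimTwo_of_giraudOverField` — a proper birational regular model on which at every
CLOSED point some non-trivial representative `Σ c_j^p g₀^j` is loosely clean (the model is
recorded with its dimension `2`). Proofs = c2's.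
-/

noncomputable section

set_option linter.dupNamespace false -- mandated namespace of this single-conjunct summit

open CategoryTheory AlgebraicGeometry TopologicalSpace IsLocalRing
open Literature.AlgebraicGeometry.Resolution Literature.AlgebraicGeometry.Motives
open scoped TensorProduct

namespace Summit.ResolutionOfSingularities.ResolutionOfSingularities.Theorems.RadicialJung.CleanModels

universe u

section Main

variable (p : ℕ) [Fact p.Prime] (k : Type) [Field k] [CharP k p]
  (hG : ∀ (X : Scheme.{0}) [IsIntegral X] [CompactSpace X] (qX : X ⟶ Spec (.of k))
    [LocallyOfFiniteType qX],
    Scheme.IsRegular X → topologicalKrullDim X = 2 →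
    ∀ f : Γ(X, ⊤),
      (∀ c : X.functionField, c ^ p ≠ (X.presheaf.germ ⊤ (genericPoint X) trivial) f) →
    ∃ (X' : Scheme.{0}) (π : X' ⟶ X), IsProper π ∧ IsIntegral X' ∧ Scheme.IsRegular X' ∧
      (∃ U : X.Opens, ((U : Set X)ᶜ).Finite ∧ (∀ x ∈ (U : Set X)ᶜ, IsClosed ({x} : Set X)) ∧
        IsIso (π ∣_ U)) ∧
      ∀ x' : X', IsClosed ({x'} : Set X') → ∃ (d r : ℕ) (hrd : r ≤ d)
        (t : Fin d → X'.presheaf.stalk x')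
        (g u : X'.presheaf.stalk x') (a : Fin r → ℕ),
        Ideal.span (Set.range t) = maximalIdeal (X'.presheaf.stalk x') ∧
        ringKrullDim (X'.presheaf.stalk x') = (d : WithBot ℕ∞) ∧ (∀ i, 2 ≤ a i) ∧
        (X'.presheaf.germ ⊤ x' trivial) (π.appTop f) =
          g ^ p + u * ∏ i : Fin r, t (Fin.castLE hrd i) ^ a i ∧
        (((∃ i, ¬ p ∣ a i) ∧ IsUnit u) ∨
          LinearIndependent (ResidueField (X'.presheaf.stalk x'))
            (fun i => ((1 : ResidueField (X'.presheaf.stalk x')) ⊗ₜ[X'.presheaf.stalk x']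
              (KaehlerDifferential.D ℤ (X'.presheaf.stalk x')
                ((Fin.snoc (fun i : Fin r => t (Fin.castLE hrd i)) u :
                  Fin (r + 1) → X'.presheaf.stalk x') i)) :
              ResidueField (X'.presheaf.stalk x') ⊗[X'.presheaf.stalk x']
                (Ω[X'.presheaf.stalk x'⁄ℤ])))))
  (W : Scheme.{0}) [IsIntegral W] (f : W ⟶ Spec (.of k)) [LocallyOfFiniteType f]
  (hW : Scheme.IsRegular W) (hdimW : topologicalKrullDim W = 2) (g₀ : W.functionField)
  (hg₀ : ∀ c : W.functionField, c ^ p ≠ g₀)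

include f hG hW hdimW hg₀ in
/-- **The induction over a list of affine opens** (over an arbitrary field, closed points). See the
module docstring. [cite: Giraud1983, Thm. 2.4 and Prop. 1.5] -/
theorem exists_model_over_list_overField (L : List W.affineOpens) :
    ∃ (V : Scheme.{0}) (π : V ⟶ W) (_ : IsIntegral V) (_ : IsDominant π) (_ : IsProper π)
      (M : Set W) (hM : IsClosed M),
      Scheme.IsRegular V ∧ topologicalKrullDim V = 2 ∧ (∀ x ∈ M, IsClosed ({x} : Set W)) ∧
      M ⊆ ((L.foldr (fun (U : W.affineOpens) (S : W.Opens) => S ⊔ U.1) ⊥ : W.Opens) : Set W) ∧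
      IsIso (π ∣_ ⟨Mᶜ, hM.isOpen_compl⟩) ∧
      ∀ v : V, IsClosed ({v} : Set V) →
        π.base v ∈ (L.foldr (fun (U : W.affineOpens) (S : W.Opens) => S ⊔ U.1) ⊥ : W.Opens) →
        ∃ c : Fin p → W.functionField, (∃ j : Fin p, (j : ℕ) ≠ 0 ∧ c j ≠ 0) ∧
        ((∃ (d m : ℕ) (hmd : m ≤ d) (t : Fin d → V.presheaf.stalk v) (a : Fin m → ℕ)
            (u : V.presheaf.stalk v), IsUnit u ∧
            Ideal.span (Set.range t) = maximalIdeal (V.presheaf.stalk v) ∧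
            ringKrullDim (V.presheaf.stalk v) = (d : WithBot ℕ∞) ∧ 0 < m ∧ (∀ i, ¬ p ∣ a i) ∧
            RatFn.functionFieldMap π (∑ j : Fin p, c j ^ p * g₀ ^ (j : ℕ)) =
              algebraMap (V.presheaf.stalk v) V.functionField
                (u * ∏ i : Fin m, t (Fin.castLE hmd i) ^ (a i))) ∨
          (∃ u : V.presheaf.stalk v, IsUnit u ∧
            RatFn.functionFieldMap π (∑ j : Fin p, c j ^ p * g₀ ^ (j : ℕ)) =
              algebraMap (V.presheaf.stalk v) V.functionField u ∧
            ∀ c' : V.presheaf.stalk v, u - c' ^ p ∉ maximalIdeal (V.presheaf.stalk v)) ∨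
          (∃ s c' : V.presheaf.stalk v,
            RatFn.functionFieldMap π (∑ j : Fin p, c j ^ p * g₀ ^ (j : ℕ)) =
              algebraMap (V.presheaf.stalk v) V.functionField s ∧
            s - c' ^ p ∈ maximalIdeal (V.presheaf.stalk v) ∧
            s - c' ^ p ∉ maximalIdeal (V.presheaf.stalk v) ^ 2)) := by
  induction L with
  | nil =>
    haveI : IsIso (𝟙 W ∣_ (⟨(∅ : Set W)ᶜ, isClosed_empty.isOpen_compl⟩ : W.Opens)) := inferInstance
    refine ⟨W, 𝟙 W, inferInstance, inferInstance, inferInstance, ∅, isClosed_empty, hW, hdimW,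
      fun x hx => hx.elim, Set.empty_subset _, this, fun v _ hv => ?_⟩
    simp at hv
  | cons U L ih =>
    obtain ⟨V, π, hVint, hπdom, hπprop, M, hM, hVreg, hdimV, hMcl, hMS, hMiso, hclean⟩ := ih
    haveI := hVint; haveI := hπdom; haveI := hπprop; haveI := hMiso
    obtain ⟨V', π', hV'int, hπ'dom, hπ'prop, M', hM', hV'reg, hdimV', hM'cl, hM'S, hM'iso,
      hclean'⟩ := exists_step_overField p k hG W f hdimW g₀ hg₀ V π hVreg hdimV
        (L.foldr (fun (U : W.affineOpens) (S : W.Opens) => S ⊔ U.1) ⊥) M hM hMcl hMS hclean U U.2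
    exact ⟨V', π', hV'int, hπ'dom, hπ'prop, M', hM', hV'reg, hdimV', hM'cl, hM'S, hM'iso, hclean'⟩

include hG hW hdimW hg₀ in
/-- **Loosely clean principalization at closed points, dimension 2, ANY ground field —
conditionally on Giraud's theorem over the field** (`hG` = the OURS statement `Giraud24OverField`,
expanded). For `W` regular integral quasi-compact of finite type over a field `k` of characteristic
`p` with `dim W = 2` and `g₀ ∈ K(W) ∖ K(W)^p`, there is a proper birational `π : V → W`, `V`
integral and regular of dimension `2`, such that at every closed `v ∈ V` some non-trivial
representative `Σ_{j<p} c_j^p g₀^j` pulls back to a loosely clean element of `𝒪_{V,v}`.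
[cite: Giraud1983, Thm. 2.4 and Prop. 1.5] -/
theorem principalizationDimTwo_of_giraudOverField [QuasiCompact f] :
    ∃ (V : Scheme.{0}) (π : V ⟶ W) (_ : IsIntegral V) (_ : IsDominant π),
      IsProper π ∧ IsBirational π ∧ Scheme.IsRegular V ∧ topologicalKrullDim V = 2 ∧
      ∀ v : V, IsClosed ({v} : Set V) →
        ∃ c : Fin p → W.functionField, (∃ j : Fin p, (j : ℕ) ≠ 0 ∧ c j ≠ 0) ∧
        ((∃ (d m : ℕ) (hmd : m ≤ d) (t : Fin d → V.presheaf.stalk v) (a : Fin m → ℕ)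
            (u : V.presheaf.stalk v), IsUnit u ∧
            Ideal.span (Set.range t) = maximalIdeal (V.presheaf.stalk v) ∧
            ringKrullDim (V.presheaf.stalk v) = (d : WithBot ℕ∞) ∧ 0 < m ∧ (∀ i, ¬ p ∣ a i) ∧
            RatFn.functionFieldMap π (∑ j : Fin p, c j ^ p * g₀ ^ (j : ℕ)) =
              algebraMap (V.presheaf.stalk v) V.functionField
                (u * ∏ i : Fin m, t (Fin.castLE hmd i) ^ (a i))) ∨
          (∃ u : V.presheaf.stalk v, IsUnit u ∧
            RatFn.functionFieldMap π (∑ j : Fin p, c j ^ p * g₀ ^ (j : ℕ)) =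
              algebraMap (V.presheaf.stalk v) V.functionField u ∧
            ∀ c' : V.presheaf.stalk v, u - c' ^ p ∉ maximalIdeal (V.presheaf.stalk v)) ∨
          (∃ s c' : V.presheaf.stalk v,
            RatFn.functionFieldMap π (∑ j : Fin p, c j ^ p * g₀ ^ (j : ℕ)) =
              algebraMap (V.presheaf.stalk v) V.functionField s ∧
            s - c' ^ p ∈ maximalIdeal (V.presheaf.stalk v) ∧
            s - c' ^ p ∉ maximalIdeal (V.presheaf.stalk v) ^ 2)) := by
  classical
  haveI : CompactSpace W := QuasiCompact.compactSpace_of_compactSpace f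
  -- a finite affine cover
  obtain ⟨t, ht⟩ := isCompact_univ.elim_finite_subcover (fun U : W.affineOpens => (U : Set W))
    (fun U => U.1.2) (fun x _ => by
      obtain ⟨_, ⟨U, hU, rfl⟩, hxU, -⟩ := W.isBasis_affineOpens.exists_subset_of_mem_open
        (Set.mem_univ x) isOpen_univ
      exact Set.mem_iUnion.mpr ⟨⟨U, hU⟩, hxU⟩)
  set L : List W.affineOpens := t.toList
  have hcov : ∀ x : W, x ∈ (L.foldr (fun (U : W.affineOpens) (S : W.Opens) => S ⊔ U.1) ⊥ : W.Opens) := by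
    intro x
    obtain ⟨U, hU⟩ := Set.mem_iUnion.mp (ht (Set.mem_univ x))
    obtain ⟨hUt, hxU⟩ := Set.mem_iUnion.mp hU
    exact (mem_foldr_sup_iff L x).mpr ⟨U, Finset.mem_toList.mpr hUt, hxU⟩
  obtain ⟨V, π, hVint, hπdom, hπprop, M, hM, hVreg, hdimV, hMcl, -, hMiso, hclean⟩ :=
    exists_model_over_list_overField p k hG W f hW hdimW g₀ hg₀ L
  haveI := hVint; haveI := hπdom; haveI := hπprop; haveI := hMiso
  have hηW : ¬ IsClosed ({genericPoint W} : Set W) :=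
    not_isClosed_singleton_genericPoint (by rw [hdimW]; decide)
  have hMdense : Dense ((⟨Mᶜ, hM.isOpen_compl⟩ : W.Opens) : Set W) :=
    dense_compl_of_forall_isClosed hM hMcl hηW
  have hMdense' : Dense ((π ⁻¹ᵁ (⟨Mᶜ, hM.isOpen_compl⟩ : W.Opens) : V.Opens) : Set V) := by
    refine (π ⁻¹ᵁ (⟨Mᶜ, hM.isOpen_compl⟩ : W.Opens)).2.dense ?_
    obtain ⟨x, hx⟩ := exists_preimage_of_isIso_morphismRestrict π ⟨Mᶜ, hM.isOpen_compl⟩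
      (y := genericPoint W) (fun hη => hηW (hMcl _ hη))
    exact ⟨x, show π.base x ∈ Mᶜ by rw [hx]; exact fun hη => hηW (hMcl _ hη)⟩
  exact ⟨V, π, hVint, hπdom, hπprop, ⟨_, hMdense, hMdense', hMiso⟩, hVreg, hdimV,
    fun v hv => hclean v hv (hcov _)⟩

end Main

end Summit.ResolutionOfSingularities.ResolutionOfSingularities.Theorems.RadicialJung.CleanModels

end
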